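import Summits.AtomisticToContinuum.HydrodynamicLimit.Theorems.ImplosionDichotomyDenseExcursionKnobFamily

/-!
# Cone locality and member-core identification: statements (line `kidder-knob-melnikov`, reshape 3)

Crux `Summit.AtomisticToContinuum.HydrodynamicLimit.Theses.ImplosionDichotomy.DenseExcursion`
(stmt-AtomisticToContinuum-12586), skeleton `Cruxes/DenseExcursion/Lines/kidder_knob_melnikov.lean` (lead's reshape 3,
2026-08-16): the statements of the two registered stubs split off the heart `stub_knobTracking` —
`stub_coneLocality : HsEulerConeLocality` and `stub_memberCore : HsEulerConeLocality → ProjectiveCovariance → MemberCore` —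
copied VERBATIM from the skeleton (over this namespace's verbatim copy of `KnobFamily`), so that the two stub files
(`…ConeLocality.lean`, `…MemberCore.lean`) and the final skeleton share ONE declaration of each. Definitions only
(plus unfolding lemmas); no mathematical claim is made here.

* `AthermalEulerAt ζ P Θ U t x` — the primitive full Euler system of a monatomic fluid with athermal law
  `p = P Θ ζ(P)`, `e = 3Θ/2`, at `(t, x) ∈ ℝ × ℝ³`, curried fields, Mathlib `deriv`/`fderiv`/`gradient` — the
  vocabulary of `Literature/Analysis/FluidPDE/IsentropicEulerFiniteSpeedOfPropagation.lean`, and the three point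
  relations `IsHardSphereEulerSolution.timeDeriv_density_eq / density_mul_timeDeriv_velocity_eq /
  timeDeriv_temperature_eq` (`HardSphereEulerPrimitiveForm.lean`) read in a chart;
* `HsEulerConeLocality` — domain of dependence in acoustic cones for two `C¹` solutions with one smooth law `ζ`
  (Dafermos 2005, Thm 5.2.1, classical case; the `5 × 5` analogue of `IsentropicEuler.eqOn_cone_of_eqOn_ball`);
* `MemberCore` — every classical ideal development of a knob member's data equals the member's reference
  fields on the straight acoustic cone of the core chart ball.
-/

noncomputable section

open MeasureTheory Set Filter Topology
open scoped ContDiff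

namespace Summit.AtomisticToContinuum.HydrodynamicLimit.Theorems.KidderKnobMelnikov

open Literature.MathematicalPhysics.KineticTheory (T3 V3 IsHardSphereEulerSolution)
open Literature.Analysis.FunctionSpaces (Torus.proj)

/-- The primitive full Euler system of a monatomic fluid with athermal pressure law `p = P Θ ζ(P)`, internal
energy `3Θ/2`, at the space–time point `(t, x) ∈ ℝ × ℝ³`, for curried fields `P, Θ : ℝ → ℝ³ → ℝ`,
`U : ℝ → ℝ³ → ℝ³`: continuity `∂ₜP + U·∇P + P div U = 0`, momentum
`P(∂ₜU + (U·∇)U) + Θ(ζ(P) + Pζ′(P))∇P + Pζ(P)∇Θ = 0`, temperature `∂ₜΘ + U·∇Θ + (2/3)Θζ(P) div U = 0`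
(`div U = ∑ᵢ (∂ᵢU)ᵢ`, `(U·∇)U = DU(U)`). `ζ ≡ 1`: the monatomic ideal gas; `ζ(r) = Z(rσ³)`: hard spheres. -/
def AthermalEulerAt (ζ : ℝ → ℝ) (P Θ : ℝ → V3 → ℝ) (U : ℝ → V3 → V3) (t : ℝ) (x : V3) : Prop :=
  deriv (fun s => P s x) t + fderiv ℝ (P t) x (U t x) +
      P t x * ∑ i, fderiv ℝ (U t) x (EuclideanSpace.single i 1) i = 0 ∧
  P t x • (deriv (fun s => U s x) t + fderiv ℝ (U t) x (U t x)) +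
      (Θ t x * (ζ (P t x) + P t x * deriv ζ (P t x))) • gradient (P t) x +
      (P t x * ζ (P t x)) • gradient (Θ t) x = 0 ∧
  deriv (fun s => Θ s x) t + fderiv ℝ (Θ t) x (U t x) +
      2 / 3 * Θ t x * ζ (P t x) * ∑ i, fderiv ℝ (U t) x (EuclideanSpace.single i 1) i = 0

/-- **Cone locality** (finite speed of propagation / local uniqueness in acoustic cones) for classical solutions of
the full Euler system of a monatomic fluid with one smooth athermal pressure law `p = ρθζ(ρ)` (Dafermos 2005,
Thm 5.2.1, classical-vs-classical case; the `5 × 5` analogue of the tree's `IsentropicEuler.eqOn_cone_of_eqOn_ball`).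
Data: `ζ` smooth on an open `J ⊇ [a, b]`, `a > 0`, hyperbolic there (`ζ + rζ′ > 0`); two triples `(Pₖ, Uₖ, Θₖ)`
jointly `C¹` on the slab `[0, t₁) × ℝ³`, solving the system at interior times on the open cone
`‖x − x₀‖ + c t < R`, with densities in `[a, b]` and positive temperatures on that cone; `c ≥ 0` dominating the
characteristic speed `‖U₁‖ + c_s(P₁, Θ₁)`, `c_s² = Θ(ζ + Pζ′) + (2/3)Θζ²` (adiabatic sound speed of the athermal
law), of the FIRST solution on the cone; equal data on the ball `‖x − x₀‖ < R`. Conclusion: the two triples agree on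
the whole cone `‖x − x₀‖ + c t < R`, `0 ≤ t < t₁`. (Proof plan: weighted symmetrised relative energy
`½(Aα² + P|w|² + Bβ²)`, `A = Θ(ζ + Pζ′)/P`, `B = 3P/(2Θ)`, flux `(U·n)e + (Θγα + Pζβ)(w·n) ≤ (‖U‖ + c_s)e`,
smooth cone weight `χ(R − ct − (ε² + ‖x − x₀‖²)^{1/2})`, Grönwall — verbatim the isentropic file's route.) -/
def HsEulerConeLocality : Prop :=
  ∀ (ζ : ℝ → ℝ) (J : Set ℝ) (a b : ℝ), IsOpen J → ContDiffOn ℝ ∞ ζ J → Set.Icc a b ⊆ J → 0 < a →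
    (∀ r ∈ Set.Icc a b, 0 < ζ r + r * deriv ζ r) →
  ∀ (P₁ Θ₁ P₂ Θ₂ : ℝ → V3 → ℝ) (U₁ U₂ : ℝ → V3 → V3) (x₀ : V3) (R c t₁ : ℝ),
    ContDiffOn ℝ 1 (fun p : ℝ × V3 => P₁ p.1 p.2) (Set.Ico 0 t₁ ×ˢ Set.univ) →
    ContDiffOn ℝ 1 (fun p : ℝ × V3 => Θ₁ p.1 p.2) (Set.Ico 0 t₁ ×ˢ Set.univ) →
    ContDiffOn ℝ 1 (fun p : ℝ × V3 => U₁ p.1 p.2) (Set.Ico 0 t₁ ×ˢ Set.univ) →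
    ContDiffOn ℝ 1 (fun p : ℝ × V3 => P₂ p.1 p.2) (Set.Ico 0 t₁ ×ˢ Set.univ) →
    ContDiffOn ℝ 1 (fun p : ℝ × V3 => Θ₂ p.1 p.2) (Set.Ico 0 t₁ ×ˢ Set.univ) →
    ContDiffOn ℝ 1 (fun p : ℝ × V3 => U₂ p.1 p.2) (Set.Ico 0 t₁ ×ˢ Set.univ) →
    (∀ t ∈ Set.Ico 0 t₁, ∀ x, ‖x - x₀‖ + c * t < R →
      P₁ t x ∈ Set.Icc a b ∧ P₂ t x ∈ Set.Icc a b ∧ 0 < Θ₁ t x ∧ 0 < Θ₂ t x) →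
    (∀ t ∈ Set.Ioo 0 t₁, ∀ x, ‖x - x₀‖ + c * t < R →
      AthermalEulerAt ζ P₁ Θ₁ U₁ t x ∧ AthermalEulerAt ζ P₂ Θ₂ U₂ t x) →
    0 ≤ c →
    (∀ t ∈ Set.Ioo 0 t₁, ∀ x, ‖x - x₀‖ + c * t < R →
      ‖U₁ t x‖ + Real.sqrt (Θ₁ t x * (ζ (P₁ t x) + P₁ t x * deriv ζ (P₁ t x)) +
        2 / 3 * Θ₁ t x * ζ (P₁ t x) ^ 2) ≤ c) →
    (∀ x, ‖x - x₀‖ < R → P₁ 0 x = P₂ 0 x ∧ U₁ 0 x = U₂ 0 x ∧ Θ₁ 0 x = Θ₂ 0 x) →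
    ∀ t ∈ Set.Ico 0 t₁, ∀ x, ‖x - x₀‖ + c * t < R → P₁ t x = P₂ t x ∧ U₁ t x = U₂ t x ∧ Θ₁ t x = Θ₂ t x

/-- **Member-core identification.** For every knob family `F`, every member `b > bLo` and every time
`t₁` before its Kidder time `T/(1 + bT)` there is a speed `c ≥ 0` (bounding the characteristic speed of the
reference on the core up to `t₁`, and `≥ Rc·b` so that the straight cone stays in the shrinking core) such that
EVERY classical ideal (`σ = 0`) development on `𝕋³` of the member's data `(a₀/∫a₀, u₀ b, θ₀)`, on any horizon
`T'`, coincides with the member's reference fields `(ρI b, uI b, θI b)` on the straight acoustic cone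
`‖y‖ + c t < Rc`, `0 ≤ t < min t₁ T'`, of the core chart. (On that region the reference IS the Kidder image of the
exact self-similar core by `selfSimilar` + `kidder`, hence a classical ideal solution by `profileODE` +
`ProjectiveCovariance`; the torus solution read in the chart is another; both have the member's data on the ball;
`HsEulerConeLocality` at `ζ ≡ 1` concludes.) This is what makes the kinematic reference fields of `KnobFamily` the
true `σ = 0` developments that `TracksTo` shadows. -/
def MemberCore : Prop :=
  ∀ (F : KnobFamily) (b t₁ : ℝ), F.bLo < b → 0 < t₁ → t₁ < F.T / (1 + b * F.T) →
    ∃ c : ℝ, 0 ≤ c ∧ ∀ (T' : ℝ) (ρ θ : ℝ → T3 → ℝ) (u : ℝ → T3 → V3),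
      IsHardSphereEulerSolution 0 T' ρ u θ → (∀ x, ρ 0 x = F.a₀ x / ∫ y, F.a₀ y) → u 0 = F.u₀ b →
      θ 0 = F.θ₀ → ∀ t ∈ Set.Ico 0 (min t₁ T'), ∀ y : V3, ‖y‖ + c * t < F.Rc →
        ρ t (F.x₀ + Torus.proj y) = F.ρI b t (F.x₀ + Torus.proj y) ∧
        u t (F.x₀ + Torus.proj y) = F.uI b t (F.x₀ + Torus.proj y) ∧
        θ t (F.x₀ + Torus.proj y) = F.θI b t (F.x₀ + Torus.proj y)

/-! ## Unfolding lemmas -/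

/-- `AthermalEulerAt` at the ideal-gas law `ζ ≡ 1`: the `ζ′`-term drops and `ζ = 1`. -/
theorem athermalEulerAt_one_iff : ∀ (P Θ : ℝ → V3 → ℝ) (U : ℝ → V3 → V3) (t : ℝ) (x : V3),
    AthermalEulerAt (fun _ => 1) P Θ U t x ↔
      (deriv (fun s => P s x) t + fderiv ℝ (P t) x (U t x) +
          P t x * ∑ i, fderiv ℝ (U t) x (EuclideanSpace.single i 1) i = 0 ∧
        P t x • (deriv (fun s => U s x) t + fderiv ℝ (U t) x (U t x)) +
          Θ t x • gradient (P t) x + P t x • gradient (Θ t) x = 0 ∧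
        deriv (fun s => Θ s x) t + fderiv ℝ (Θ t) x (U t x) +
          2 / 3 * Θ t x * ∑ i, fderiv ℝ (U t) x (EuclideanSpace.single i 1) i = 0) := by
  intro P Θ U t x
  unfold AthermalEulerAt
  simp only [deriv_const', mul_zero, add_zero, mul_one]

/-- The three conclusions of `HsEulerConeLocality` at one point, as a reusable projection. -/
theorem HsEulerConeLocality.eq_of_cone (h : HsEulerConeLocality) {ζ : ℝ → ℝ} {J : Set ℝ} {a b : ℝ}
    (hJ : IsOpen J) (hζ : ContDiffOn ℝ ∞ ζ J) (hab : Set.Icc a b ⊆ J) (ha : 0 < a)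
    (hγ : ∀ r ∈ Set.Icc a b, 0 < ζ r + r * deriv ζ r)
    {P₁ Θ₁ P₂ Θ₂ : ℝ → V3 → ℝ} {U₁ U₂ : ℝ → V3 → V3} {x₀ : V3} {R c t₁ : ℝ}
    (hP₁ : ContDiffOn ℝ 1 (fun p : ℝ × V3 => P₁ p.1 p.2) (Set.Ico 0 t₁ ×ˢ Set.univ))
    (hΘ₁ : ContDiffOn ℝ 1 (fun p : ℝ × V3 => Θ₁ p.1 p.2) (Set.Ico 0 t₁ ×ˢ Set.univ))
    (hU₁ : ContDiffOn ℝ 1 (fun p : ℝ × V3 => U₁ p.1 p.2) (Set.Ico 0 t₁ ×ˢ Set.univ))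
    (hP₂ : ContDiffOn ℝ 1 (fun p : ℝ × V3 => P₂ p.1 p.2) (Set.Ico 0 t₁ ×ˢ Set.univ))
    (hΘ₂ : ContDiffOn ℝ 1 (fun p : ℝ × V3 => Θ₂ p.1 p.2) (Set.Ico 0 t₁ ×ˢ Set.univ))
    (hU₂ : ContDiffOn ℝ 1 (fun p : ℝ × V3 => U₂ p.1 p.2) (Set.Ico 0 t₁ ×ˢ Set.univ))
    (hrange : ∀ t ∈ Set.Ico 0 t₁, ∀ x, ‖x - x₀‖ + c * t < R →
      P₁ t x ∈ Set.Icc a b ∧ P₂ t x ∈ Set.Icc a b ∧ 0 < Θ₁ t x ∧ 0 < Θ₂ t x)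
    (hE : ∀ t ∈ Set.Ioo 0 t₁, ∀ x, ‖x - x₀‖ + c * t < R →
      AthermalEulerAt ζ P₁ Θ₁ U₁ t x ∧ AthermalEulerAt ζ P₂ Θ₂ U₂ t x)
    (hc : 0 ≤ c)
    (hspeed : ∀ t ∈ Set.Ioo 0 t₁, ∀ x, ‖x - x₀‖ + c * t < R →
      ‖U₁ t x‖ + Real.sqrt (Θ₁ t x * (ζ (P₁ t x) + P₁ t x * deriv ζ (P₁ t x)) +
        2 / 3 * Θ₁ t x * ζ (P₁ t x) ^ 2) ≤ c)
    (h0 : ∀ x, ‖x - x₀‖ < R → P₁ 0 x = P₂ 0 x ∧ U₁ 0 x = U₂ 0 x ∧ Θ₁ 0 x = Θ₂ 0 x)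
    {t : ℝ} (ht : t ∈ Set.Ico 0 t₁) {x : V3} (hx : ‖x - x₀‖ + c * t < R) :
    P₁ t x = P₂ t x ∧ U₁ t x = U₂ t x ∧ Θ₁ t x = Θ₂ t x :=
  h ζ J a b hJ hζ hab ha hγ P₁ Θ₁ P₂ Θ₂ U₁ U₂ x₀ R c t₁ hP₁ hΘ₁ hU₁ hP₂ hΘ₂ hU₂ hrange hE hc hspeed h0 t ht x hx

end Summit.AtomisticToContinuum.HydrodynamicLimit.Theorems.KidderKnobMelnikov

end
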